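import Summits.FinalStateConjecture.FinalStateConjecture.Theorems.SwallowTheDatumUniversalWitnessFamilyStubPlugDataPlusFromOfAux3

/-!
# Stub `stub_plugDataPlusFrom_of` of the line `Sketch` (crux `SwallowTheDatum.UniversalWitnessFamily`,
# item stmt-FinalStateConjecture-10051): PlugData⁺ with prescribed exterior mass from the Mao–Oh–Tao gluing theorem

The registered stub `stub_plugDataPlusFrom_of` (crux 10052 gen-1's `stub_plugDataPlus_of` with the exterior mass `M` exported and
the bulk hypothesis repaired), proved: a smooth datum on `ℝ³` solving the vacuum constraints EVERYWHERE, exactly time-symmetric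
isotropic Schwarzschild(`M`) beyond `ρ₃ < M/40`, and exactly `λ⁻²`·Schwarzschild(`λμ`) on `{λ < |y| < 2λ}`, `0 < μ ≤ μ₀`.  The printed
gluing theorem (Mao–Oh–Tao arXiv:2308.13031, Thm 1.7, vendored as `MaoOhTao.ObstructionFreeAnnularGluing`) enters only as the HYPOTHESIS,
through `mot_apply`, and is applied `N + 3` times at unit scale; every analytic inequality arrives packaged (`SchwOutSite`, `BulkAt`,
`CapEndAt`).  §1–§4 (namespace `PlugDataPlus`; `hmot` = the body of `mot_apply` for fixed thresholds): `exists_lumpCore` (flat core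
against the smoothed Schwarzschild(`m`) far field, read at scale `64`), `exists_siteSurgery` (one site against the pure pull-back
reading of `B`), `exists_sitesSurgery` (finitely many well-separated sites, `exists_patch_balls`), `exists_capEnd` (the end through
the inversion chart).  Then the stub: fix `η` (`exists_isBump`), the thresholds `εo, μo`, the bulk threshold `μ′₀` at mass `M`, the
lump mass `m ≤ min μ₀ μ′₀`, the Brill–Lindquist bulk `B` at core mass `m`; lump → sites (`Gr₀` at the centre, `MOTHyp` moved to
`Gr₀.coordH` by locality; flat cores elsewhere) → end; bookkeeping `λ := s 0`, `μ := m/64` (the socket annulus lies in `B(0, 2 s₀)`,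
untouched by the later surgeries, where the datum reads `Gr₀` at scale `s 0`).

References: Mao–Oh–Tao arXiv:2308.13031, Thm 1.7, Rem 1.9, 1.11; Brill–Lindquist, Phys. Rev. 131 (1963) 471; Bartnik–Isenberg 2004, §2.
-/
-- the doubled `FinalStateConjecture` path component is the summit/problem naming scheme, not a mistake
set_option linter.dupNamespace false
-- instance search through the nested operator type `E3 →L[ℝ] E3 →L[ℝ] ℝ`
set_option maxSynthPendingDepth 3

noncomputable section
namespace Summit.FinalStateConjecture.FinalStateConjecture.Theorems.SwallowTheDatum.UniversalWitnessFamily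

open scoped Manifold ContDiff Topology BigOperators InnerProductSpace
open Set Filter Function Literature.Geometry.Lorentzian Literature.Geometry.Lorentzian.MaoOhTao
  Literature.Geometry.Lorentzian.InitialDataSet
open Summit.FinalStateConjecture.FinalStateConjecture.Theorems.SwallowTheDatum.ParametricKerrBurial

namespace PlugDataPlus

variable {η : ℝ → ℝ} {εo μo : ℝ}

/-! ## §1 The lump -/

/-- **The lump, read at scale `64`.** Glue the flat in-core `F` to the smoothed Schwarzschild(`m`) far field `S` (the Thm-1.7
hypothesis block being given), obtaining an everywhere-vacuum datum equal to `S` beyond radius `32`; its affine reading at scale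
`64` is everywhere vacuum with fields exactly `schwField (m/64)`, `0` on `{|y| > 1/2}`. [cite: MaoOhTao2023, Thm 1.7, Rem 1.11] -/
theorem exists_lumpCore
    (hmot : ∀ (Din Dout : InitialDataSet (𝓡 3) E3) (sIn sOut : ℝ), Din.VacOn 1 2 → Dout.VacOn 32 64 →
      MOTHyp η εo μo Din.coordH Din.coordK Dout.coordH Dout.coordK sIn sOut →
      ∃ D : InitialDataSet (𝓡 3) E3,
        D.VacOn 1 64 ∧ (∀ y : E3, ‖y‖ < 2 → D.SameAt Din y) ∧ (∀ y : E3, 32 < ‖y‖ → D.SameAt Dout y))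
    {F S : InitialDataSet (𝓡 3) E3} {m sOut : ℝ} (hF : FlatVacuumDatum F) (hS : SchwDatum m S)
    (hH : MOTHyp η εo μo flatField zeroField S.coordH S.coordK 0 sOut) :
    ∃ Gr₀ : InitialDataSet (𝓡 3) E3, (∀ y : E3, VacAt Gr₀ y) ∧
      ∀ y : E3, 1 / 2 < ‖y‖ → Gr₀.coordH y = schwField (m / 64) y ∧ Gr₀.coordK y = zeroField y := by
  rw [← coordH_eq_flatField hF, ← coordK_eq_zeroField hF] at hH
  have hFOn : F.VacOn 1 2 := (vacOn_iff F 1 2).2 fun y _ _ ↦ hF.2 y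
  have hSOn : S.VacOn 32 64 := (vacOn_iff S 32 64).2 fun y h1 _ ↦ hS.2 y (by linarith)
  obtain ⟨L, hLvac, hLin, hLout⟩ := hmot F S 0 sOut hFOn hSOn hH
  -- `L` is vacuum everywhere
  have hLall : ∀ y : E3, VacAt L y := by
    intro y
    by_cases h2 : ‖y‖ < 2
    · refine (vacAt_congr_nhds ?_).2 (hF.2 y)
      filter_upwards [(isOpen_lt continuous_norm continuous_const).mem_nhds h2] with z hz using hLin z hz
    by_cases h32 : 32 < ‖y‖
    · refine (vacAt_congr_nhds ?_).2 (hS.2 y (by linarith))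
      filter_upwards [(isOpen_outside_zero 32).mem_nhds h32] with z hz using hLout z hz
    · exact (vacOn_iff L 1 64).1 hLvac y (by linarith [not_lt.1 h2]) (by linarith [not_lt.1 h32])
  -- read at scale `64`, normalisation `1`
  obtain ⟨Gr, hGr, hGrvac, -⟩ := readTransplantAt_of_pos L 0 (by norm_num : (0 : ℝ) < 64) one_pos
  refine ⟨Gr, fun y ↦ hGrvac y (hLall _), fun y hy ↦ ?_⟩
  have hn : ‖(0 : E3) + (64 : ℝ) • y‖ = 64 * ‖y‖ := by
    rw [zero_add, norm_smul, Real.norm_eq_abs, abs_of_pos (by norm_num : (0 : ℝ) < 64)]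
  have hy32 : 32 < ‖(0 : E3) + (64 : ℝ) • y‖ := by rw [hn]; linarith
  have hy4 : 1 / 4 < ‖(0 : E3) + (64 : ℝ) • y‖ := by rw [hn]; linarith
  obtain ⟨hh, hk⟩ := hLout _ hy32
  obtain ⟨hSh, hSk⟩ := hS.1 _ hy4
  refine ⟨coordH_eq_schwField fun v w ↦ ?_, ?_⟩
  · rw [(hGr y v w).1, one_pow, one_mul, show L.h.inner ((0 : E3) + (64 : ℝ) • y) v w =
      S.h.inner ((0 : E3) + (64 : ℝ) • y) v w by rw [hh], hSh v w, hn]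
    rcases eq_or_ne y 0 with rfl | hy0
    · simp
    · have hy' : ‖y‖ ≠ 0 := norm_ne_zero_iff.2 hy0
      rw [show m / (2 * (64 * ‖y‖)) = m / 64 / (2 * ‖y‖) by field_simp]
  · ext v w
    rw [coordK_apply, (hGr y v w).2, show L.k ((0 : E3) + (64 : ℝ) • y) v w = S.k ((0 : E3) + (64 : ℝ) • y) v w by rw [hk],
      hSk]
    simp [zeroField]

/-! ## §2 One site -/

/-- **Surgery at one site.** Given the in-datum `Din` (vacuum on `B₂`) and a datum `B` vacuum on the shell
`{32 s < |y − c| < 64 s}` such that the Thm-1.7 hypothesis block holds for `Din` against the pure pull-back reading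
`s² h_B(c + s y)` of `B`, there is a datum `G′` equal to `B` off `B̄(c, 32 s)`, vacuum on `B(c, 64 s)`, reading `Din` on `B(c, 2 s)`:
`s² h_{G′}(y) = h_{Din}((y − c)/s)`. [cite: MaoOhTao2023, Thm 1.7] -/
theorem exists_siteSurgery
    (hmot : ∀ (Din Dout : InitialDataSet (𝓡 3) E3) (sIn sOut : ℝ), Din.VacOn 1 2 → Dout.VacOn 32 64 →
      MOTHyp η εo μo Din.coordH Din.coordK Dout.coordH Dout.coordK sIn sOut →
      ∃ D : InitialDataSet (𝓡 3) E3,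
        D.VacOn 1 64 ∧ (∀ y : E3, ‖y‖ < 2 → D.SameAt Din y) ∧ (∀ y : E3, 32 < ‖y‖ → D.SameAt Dout y))
    (B Din : InitialDataSet (𝓡 3) E3) (c : E3) {s sIn sOut : ℝ} (hs : 0 < s)
    (hDin : ∀ y : E3, ‖y‖ < 2 → VacAt Din y)
    (hB : ∀ y : E3, 32 * s < ‖y - c‖ → ‖y - c‖ < 64 * s → VacAt B y)
    (hH : MOTHyp η εo μo Din.coordH Din.coordK (fun y ↦ s ^ 2 • B.coordH (c + s • y))
      (fun y ↦ s ^ 2 • B.coordK (c + s • y)) sIn sOut) :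
    ∃ G' : InitialDataSet (𝓡 3) E3,
      (∀ y : E3, 32 * s < ‖y - c‖ → G'.SameAt B y) ∧
      (∀ y : E3, ‖y - c‖ < 64 * s → VacAt G' y) ∧
      (∀ y v w : E3, ‖y - c‖ < 2 * s →
        s ^ 2 * G'.h.inner y v w = Din.h.inner (s⁻¹ • (y - c)) v w ∧
          s ^ 2 * G'.k y v w = Din.k (s⁻¹ • (y - c)) v w) := by
  obtain ⟨Gr, hGr, hGrvac, htrans⟩ := readTransplantAt_of_pos B c hs hs
  -- the out-reading's coefficient fields are the pure pull-back fields
  have hGrH : Gr.coordH = fun y ↦ s ^ 2 • B.coordH (c + s • y) := by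
    funext y
    ext v w
    rw [coordH_apply, (hGr y v w).1]
    rfl
  have hGrK : Gr.coordK = fun y ↦ s ^ 2 • B.coordK (c + s • y) := by
    funext y
    ext v w
    rw [coordK_apply, (hGr y v w).2, ← pow_two]
    rfl
  have hnorm : ∀ y : E3, ‖c + s • y - c‖ = s * ‖y‖ := fun y ↦ by
    rw [add_sub_cancel_left, norm_smul, Real.norm_eq_abs, abs_of_pos hs]
  have hGrOn : Gr.VacOn 32 64 := by
    rw [vacOn_iff]
    intro y h1 h2
    refine hGrvac y (hB _ ?_ ?_) <;> rw [hnorm] <;> nlinarith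
  have hDinOn : Din.VacOn 1 2 := (vacOn_iff Din 1 2).2 fun y _ h2 ↦ hDin y h2
  rw [← hGrH, ← hGrK] at hH
  obtain ⟨Dh, hDhvac, hDhin, hDhout⟩ := hmot Din Gr sIn sOut hDinOn hGrOn hH
  obtain ⟨G', hG'f, hG'same, hG'vac⟩ := htrans Dh 32 (by norm_num) hDhout
  -- vacuum of the glued unit-scale datum inside `B₆₄`
  have hDhall : ∀ y : E3, ‖y‖ < 64 → VacAt Dh y := by
    intro y hy
    by_cases h2 : ‖y‖ < 2
    · refine (vacAt_congr_nhds ?_).2 (hDin y h2)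
      filter_upwards [(isOpen_lt continuous_norm continuous_const).mem_nhds h2] with z hz using hDhin z hz
    · exact (vacOn_iff Dh 1 64).1 hDhvac y (by linarith [not_lt.1 h2]) hy
  refine ⟨G', hG'same, fun y hy ↦ ?_, fun y v w hy ↦ ?_⟩
  · have hy' : ‖s⁻¹ • (y - c)‖ < 64 := by
      rw [norm_smul_sub c hs, inv_mul_lt_iff₀ hs]
      linarith
    have key : VacAt G' (c + s • (s⁻¹ • (y - c))) := hG'vac _ (hDhall _ hy')
    rwa [affine_smul_sub c hs.ne'] at key
  · have hy' : ‖s⁻¹ • (y - c)‖ < 2 := by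
      rw [norm_smul_sub c hs, inv_mul_lt_iff₀ hs]
      linarith
    obtain ⟨e1, e2⟩ := hG'f (s⁻¹ • (y - c)) v w
    rw [affine_smul_sub c hs.ne'] at e1 e2
    obtain ⟨hh, hk⟩ := hDhin _ hy'
    refine ⟨?_, ?_⟩
    · rw [e1, hh]
    · rw [pow_two, e2, hk]

/-! ## §3 Finitely many sites -/

/-- **Surgery at finitely many well-separated sites** of a datum `B` vacuum off the balls `B(c_j, s_j)`, the gluing balls
`B(c_j, 64 s_j)` being pairwise far apart (`160(s_i + s_j) < |c_i − c_j|`): the result is vacuum EVERYWHERE, equal to `B` off the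
closed balls `B̄(c_j, 32 s_j)`, and reads the in-datum `Din_j` on `B(c_j, 2 s_j)`. [cite: MaoOhTao2023, Thm 1.7] -/
theorem exists_sitesSurgery
    (hmot : ∀ (Din Dout : InitialDataSet (𝓡 3) E3) (sIn sOut : ℝ), Din.VacOn 1 2 → Dout.VacOn 32 64 →
      MOTHyp η εo μo Din.coordH Din.coordK Dout.coordH Dout.coordK sIn sOut →
      ∃ D : InitialDataSet (𝓡 3) E3,
        D.VacOn 1 64 ∧ (∀ y : E3, ‖y‖ < 2 → D.SameAt Din y) ∧ (∀ y : E3, 32 < ‖y‖ → D.SameAt Dout y))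
    {N : ℕ} (B : InitialDataSet (𝓡 3) E3) (Din : Fin (N + 1) → InitialDataSet (𝓡 3) E3) (c : Fin (N + 1) → E3)
    (s sIn sOut : Fin (N + 1) → ℝ) (hs : ∀ j, 0 < s j) (hsep : ∀ i j, i ≠ j → 160 * s i + 160 * s j < ‖c i - c j‖)
    (hBvac : ∀ y : E3, (∀ j, s j ≤ ‖y - c j‖) → VacAt B y) (hDin : ∀ j (y : E3), ‖y‖ < 2 → VacAt (Din j) y)
    (hH : ∀ j, MOTHyp η εo μo (Din j).coordH (Din j).coordK (fun y ↦ (s j) ^ 2 • B.coordH (c j + s j • y))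
      (fun y ↦ (s j) ^ 2 • B.coordK (c j + s j • y)) (sIn j) (sOut j)) :
    ∃ G : InitialDataSet (𝓡 3) E3,
      (∀ y : E3, VacAt G y) ∧
      (∀ y : E3, (∀ j, 32 * s j < ‖y - c j‖) → G.SameAt B y) ∧
      (∀ j (y v w : E3), ‖y - c j‖ < 2 * s j →
        (s j) ^ 2 * G.h.inner y v w = (Din j).h.inner ((s j)⁻¹ • (y - c j)) v w ∧
          (s j) ^ 2 * G.k y v w = (Din j).k ((s j)⁻¹ • (y - c j)) v w) := by
  -- `B` is vacuum on every gluing shell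
  have hB : ∀ j (y : E3), 32 * s j < ‖y - c j‖ → ‖y - c j‖ < 64 * s j → VacAt B y := by
    intro j y h1 h2
    refine hBvac y fun i ↦ ?_
    by_cases hij : i = j
    · subst hij
      linarith [hs i]
    · have htri : ‖c i - c j‖ ≤ ‖y - c j‖ + ‖y - c i‖ :=
        calc ‖c i - c j‖ = ‖(y - c j) - (y - c i)‖ := by congr 1; abel
          _ ≤ ‖y - c j‖ + ‖y - c i‖ := norm_sub_le _ _
      linarith [hsep i j hij, hs i, hs j]
  choose G' hG'same hG'vac hG'f using
    fun j ↦ exists_siteSurgery hmot B (Din j) (c j) (hs j) (hDin j) (hB j) (hH j)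
  obtain ⟨G, hG1, hG2, hG3, hG4⟩ := exists_patch_balls B G' c (fun j ↦ 32 * s j) (fun j ↦ 64 * s j)
    (fun j ↦ by linarith [hs j]) (fun i j hij ↦ by linarith [hsep i j hij, hs i, hs j]) hG'same
  refine ⟨G, fun y ↦ ?_, hG2, fun j y v w hy ↦ ?_⟩
  · by_cases h : ∃ j, ‖y - c j‖ < 64 * s j
    · obtain ⟨j, hj⟩ := h
      exact (hG3 j y hj).2 (hG'vac j y hj)
    · push Not at h
      exact (hG4 y fun j ↦ by linarith [h j, hs j]).2 (hBvac y fun j ↦ by linarith [h j, hs j])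
  · obtain ⟨hh, hk⟩ := hG1 j y (by linarith [hs j])
    obtain ⟨e1, e2⟩ := hG'f j y v w hy
    rw [hh, hk]
    exact ⟨e1, e2⟩

/-! ## §4 The end -/

/-- `|inv ρ₃ x| = ρ₃/|x|` for `x ≠ 0`, `ρ₃ ≥ 0`. [folklore] -/
theorem norm_sheetInv {ρ₃ : ℝ} (hρ₃ : 0 ≤ ρ₃) {x : E3} (hx : x ≠ 0) : ‖inv ρ₃ x‖ = ρ₃ / ‖x‖ := by
  have hx' : 0 < ‖x‖ := norm_pos_iff.2 hx
  rw [inv, norm_smul, Real.norm_eq_abs, abs_of_nonneg (div_nonneg hρ₃ (sq_nonneg _))]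
  field_simp

/-- **Capping the end.** Given the capping statement `CapEndAt M ρ₃ X₃` for every datum, an everywhere-vacuum datum `G` equal to
`B` on `{|y| ≥ ρ₃/256}`, the smoothed sheet-2 far field `S_e` (`SchwDatum (M/X₃)`) and the Thm-1.7 hypothesis block for
`schwField (M/X₃)` against the inverted reading of `B`: glue `S_e` to the inverted reading of `G` (which IS that of `B` on
`{16 < |x| < 128}`) and transplant back — an everywhere-vacuum datum, exactly Schwarzschild(`M`) beyond `ρ₃/2`, equal to `G`
inside `B(0, ρ₃/32)`. [cite: MaoOhTao2023, Thm 1.7] -/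
theorem exists_capEnd (hη : IsBump η)
    (hmot : ∀ (Din Dout : InitialDataSet (𝓡 3) E3) (sIn sOut : ℝ), Din.VacOn 1 2 → Dout.VacOn 32 64 →
      MOTHyp η εo μo Din.coordH Din.coordK Dout.coordH Dout.coordK sIn sOut →
      ∃ D : InitialDataSet (𝓡 3) E3,
        D.VacOn 1 64 ∧ (∀ y : E3, ‖y‖ < 2 → D.SameAt Din y) ∧ (∀ y : E3, 32 < ‖y‖ → D.SameAt Dout y))
    {M ρ₃ X₃ sM sEnd : ℝ} (hρ₃ : 0 < ρ₃) (hcap : ∀ G : InitialDataSet (𝓡 3) E3, CapEndAt M ρ₃ X₃ G)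
    {B G Se : InitialDataSet (𝓡 3) E3} (hSe : SchwDatum (M / X₃) Se) (hGvac : ∀ y : E3, VacAt G y)
    (hGB : ∀ y : E3, ρ₃ / 256 ≤ ‖y‖ → G.SameAt B y)
    (hH : MOTHyp η εo μo (schwField (M / X₃)) zeroField (invReadH B ρ₃ X₃) (invReadK B ρ₃ X₃) sM sEnd) :
    ∃ P : InitialDataSet (𝓡 3) E3,
      (∀ y : E3, VacAt P y) ∧
      (∀ y : E3, ρ₃ / 2 < ‖y‖ →
        (∀ v w : E3, P.h.inner y v w = Schwarzschild.conformalFactor M y ^ 4 * ⟪v, w⟫_ℝ) ∧ P.k y = 0) ∧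
      (∀ y : E3, ‖y‖ < ρ₃ / 32 → P.SameAt G y) := by
  obtain ⟨Gh, hGhf, hGhvac, hGht⟩ := hcap G
  -- the in-fields near `[1, 2]`
  have hIn : ∀ x ∈ {x : E3 | 1 / 4 < ‖x‖}, Se.coordH x = schwField (M / X₃) x ∧ Se.coordK x = zeroField x :=
    fun x hx ↦ ⟨coordH_eq_schwField (hSe.1 x hx).1, (hSe.1 x hx).2⟩
  -- the out-fields near `[32, 64]`: the inverted reading of `G` is that of `B`
  have hOut : ∀ x ∈ {x : E3 | 16 < ‖x‖ ∧ ‖x‖ < 128},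
      Gh.coordH x = invReadH B ρ₃ X₃ x ∧ Gh.coordK x = invReadK B ρ₃ X₃ x := by
    intro x hx
    have hx0 : x ≠ 0 := by
      rintro rfl
      simp only [mem_setOf_eq, norm_zero] at hx
      linarith [hx.1]
    have hxi : ρ₃ / 256 ≤ ‖inv ρ₃ x‖ := by
      rw [norm_sheetInv hρ₃.le hx0]
      exact div_le_div_of_nonneg_left hρ₃.le (norm_pos_iff.2 hx0) (by linarith [hx.2])
    obtain ⟨hh, hk⟩ := hGB _ hxi
    obtain ⟨h1, h2⟩ := hGhf x (by linarith [hx.1])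
    refine ⟨?_, ?_⟩
    · rw [h1, invReadH, invReadH, show G.coordH (inv ρ₃ x) = B.coordH (inv ρ₃ x) from hh]
    · rw [h2, invReadK, invReadK, show G.coordK (inv ρ₃ x) = B.coordK (inv ρ₃ x) from hk]
  have hH' : MOTHyp η εo μo Se.coordH Se.coordK Gh.coordH Gh.coordK sM sEnd :=
    motHyp_congr hη (isOpen_outside_zero (1 / 4))
      ((isOpen_lt continuous_const continuous_norm).inter (isOpen_lt continuous_norm continuous_const))
      (fun x h1 _ ↦ show 1 / 4 < ‖x‖ by linarith) (fun x h1 h2 ↦ show 16 < ‖x‖ ∧ ‖x‖ < 128 from ⟨by linarith, by linarith⟩)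
      (fun x hx ↦ (hIn x hx).1) (fun x hx ↦ (hIn x hx).2) (fun x hx ↦ (hOut x hx).1) (fun x hx ↦ (hOut x hx).2) hH
  have hSeOn : Se.VacOn 1 2 := (vacOn_iff _ _ _).2 fun x h1 _ ↦ hSe.2 x (by linarith)
  have hGhOn : Gh.VacOn 32 64 := (vacOn_iff _ _ _).2 fun x h1 _ ↦ hGhvac x (by linarith) (hGvac _)
  obtain ⟨De, hDevac, hDein, hDeout⟩ := hmot Se Gh sM sEnd hSeOn hGhOn hH'
  -- the sheet-2 field of the glued unit-scale datum on `(1/4, 2)`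
  have hsheet : ∀ x : E3, 1 / 4 < ‖x‖ → ‖x‖ < 2 →
      (∀ v w : E3, De.h.inner x v w = (1 + M / (2 * X₃ * ‖x‖)) ^ 4 * ⟪v, w⟫_ℝ) ∧ De.k x = 0 := by
    intro x h1 h2
    obtain ⟨hh, hk⟩ := hDein x h2
    obtain ⟨hSh, hSk⟩ := hSe.1 x h1
    refine ⟨fun v w ↦ ?_, by rw [hk, hSk]⟩
    rw [show De.h.inner x v w = Se.h.inner x v w by rw [hh], hSh v w,
      show M / X₃ / (2 * ‖x‖) = M / (2 * X₃ * ‖x‖) by ring]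
  obtain ⟨P, hP1, hP2, hP3, hP4, hP5⟩ := hGht De hDeout hsheet
  refine ⟨P, fun y ↦ ?_, hP1, hP2⟩
  by_cases h1 : ρ₃ / 2 < ‖y‖
  · exact hP3 y h1
  by_cases h2 : ρ₃ / 64 < ‖y‖
  · have hy0 : y ≠ 0 := fun h ↦ by rw [h, norm_zero] at h2; linarith
    have hyn : 0 < ‖y‖ := norm_pos_iff.2 hy0
    refine hP4 y h2 (by linarith) ((vacOn_iff De 1 64).1 hDevac _ ?_ ?_)
    · rw [norm_sheetInv hρ₃.le hy0, lt_div_iff₀ hyn]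
      linarith [not_lt.1 h1]
    · rw [norm_sheetInv hρ₃.le hy0, div_lt_iff₀ hyn]
      linarith
  · exact hP5 y (by linarith [not_lt.1 h2]) (hGvac y)

end PlugDataPlus

open PlugDataPlus
/-! ## §5 The registered stub -/

/-- **Stub `stub_plugDataPlusFrom_of`: PlugData⁺ with prescribed exterior mass `M`.** From the printed gluing theorem of
Mao–Oh–Tao (hypothesis `ObstructionFreeAnnularGluing`), the capping statement `CapEndAt`, the flat and smoothed-Schwarzschild
model data, the Schwarzschild OUT-site and the Brill–Lindquist bulk (in its repaired form: for every `M`, all sufficiently small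
core masses), for every compactness bound `μ₀ > 0` and every `M > 0`: a datum `D₀` on `ℝ³` solving the vacuum constraints
everywhere, exactly isotropic Schwarzschild(`M`) with `k = 0` beyond `ρ₃ < M/40`, and exactly `λ⁻²(1 + λμ/2|y|)⁴ δ`, `k = 0` on
`{λ < |y| < 2λ}`, `2λ < ρ₃`, `0 < μ ≤ μ₀` — the gluing theorem applied `N + 3` times at unit scale (lump, `N + 1` sites, end) with
`λ := s 0`, `μ := m/64`. [cite: MaoOhTao2023, Thm 1.7] -/
theorem stub_plugDataPlusFrom_of :
  ObstructionFreeAnnularGluing →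
    (∀ (M ρ₃ X₃ : ℝ), 0 < M → 0 < ρ₃ → 0 < X₃ → X₃ * ρ₃ = (M / 2) ^ 2 →
      ∀ G : InitialDataSet (𝓡 3) E3, CapEndAt M ρ₃ X₃ G) →
    (∃ F : InitialDataSet (𝓡 3) E3, FlatVacuumDatum F) →
    (∀ m : ℝ, 0 < m → ∃ S : InitialDataSet (𝓡 3) E3, SchwDatum m S) →
    (∀ η : ℝ → ℝ, IsBump η → ∀ (εo μo μ₀ : ℝ), 0 < εo → 0 < μo → 0 < μ₀ →
      ∃ (m sOut θ : ℝ), 0 < m ∧ m ≤ μ₀ ∧ 0 < θ ∧ SchwOutSite η εo μo m sOut θ) →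
    (∀ η : ℝ → ℝ, IsBump η → ∀ (εo μo M : ℝ), 0 < εo → 0 < μo → 0 < M →
      ∃ μ'₀ : ℝ, 0 < μ'₀ ∧ ∀ μ' : ℝ, 0 < μ' → μ' ≤ μ'₀ → BulkAt η εo μo M μ') →
    ∀ μ₀ : ℝ, 0 < μ₀ → ∀ M : ℝ, 0 < M →
      ∃ (μ ρ₃ lam : ℝ) (D₀ : InitialDataSet (𝓡 3) E3),
        0 < μ ∧ μ ≤ μ₀ ∧ 0 < ρ₃ ∧ ρ₃ < M / 40 ∧ 0 < lam ∧ 2 * lam < ρ₃ ∧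
        (∀ [D₀.metric.HasLeviCivita], D₀.IsVacuumConstraintSolution) ∧
        (∀ y : E3, ρ₃ < ‖y‖ →
          (∀ v w : E3, D₀.h.inner y v w = Schwarzschild.conformalFactor M y ^ 4 * ⟪v, w⟫_ℝ) ∧ D₀.k y = 0) ∧
        (∀ y : E3, lam < ‖y‖ → ‖y‖ < 2 * lam →
          (∀ v w : E3, D₀.h.inner y v w = (lam ^ 2)⁻¹ * (1 + lam * μ / (2 * ‖y‖)) ^ 4 * ⟪v, w⟫_ℝ) ∧
            D₀.k y = 0) := by
  intro hMOT hcap hFex hSex hsite hbulk μ₀ hμ₀ M hM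
  -- §0 parameters
  obtain ⟨η, hη⟩ := ParametricKerrBurial.exists_isBump
  obtain ⟨εo, μo, hεo, hμo, hmot⟩ := mot_apply hMOT hη
  obtain ⟨μ'₀, hμ'₀, hbulk'⟩ := hbulk η hη εo μo M hεo hμo hM
  obtain ⟨m, sOutS, θ, hm, hmle, hθ, hsiteS⟩ := hsite η hη εo μo (min μ₀ μ'₀) hεo hμo (lt_min hμ₀ hμ'₀)
  obtain ⟨ρ₃, X₃, N, c, s, sOut, sIn₀, sM, sEnd, B, hρ₃, hρ₃M, hX₃, hX₃ρ₃, hc0, hs, hcs, hsep, -, hBvac, hHj, -, hH0, -,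
    hHend⟩ := hbulk' m hm (hmle.trans (min_le_right _ _))
  obtain ⟨F, hF⟩ := hFex
  obtain ⟨S, hS⟩ := hSex m hm
  obtain ⟨Se, hSe⟩ := hSex (M / X₃) (div_pos hM hX₃)
  -- §1 the lump, read at scale `64`
  obtain ⟨Gr₀, hGr₀vac, hGr₀f⟩ := exists_lumpCore hmot hF hS (motHyp_flat_of_schwOutSite hsiteS hθ hS)
  -- §2 the sites: in-data `Gr₀` at the centre, the flat core elsewhere
  classical
  let Din : Fin (N + 1) → InitialDataSet (𝓡 3) E3 := fun j ↦ if j = 0 then Gr₀ else F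
  let sIn : Fin (N + 1) → ℝ := fun j ↦ if j = 0 then sIn₀ else 0
  have hDin0 : Din 0 = Gr₀ := if_pos rfl
  have hDinvac : ∀ j (y : E3), ‖y‖ < 2 → VacAt (Din j) y := by
    intro j
    by_cases hj : j = 0
    · rw [show Din j = Gr₀ from if_pos hj]
      exact fun y _ ↦ hGr₀vac y
    · rw [show Din j = F from if_neg hj]
      exact fun y _ ↦ hF.2 y
  have hHj' : ∀ j, MOTHyp η εo μo (Din j).coordH (Din j).coordK (fun y ↦ (s j) ^ 2 • B.coordH (c j + s j • y))
      (fun y ↦ (s j) ^ 2 • B.coordK (c j + s j • y)) (sIn j) (sOut j) := by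
    intro j
    by_cases hj : j = 0
    · subst hj
      simp only [Din, sIn, if_true]
      exact motHyp_congr hη (isOpen_outside_zero (1 / 2)) isOpen_univ (fun x h1 _ ↦ show 1 / 2 < ‖x‖ by linarith)
        (fun x _ _ ↦ mem_univ x) (fun x hx ↦ (hGr₀f x hx).1) (fun x hx ↦ (hGr₀f x hx).2) (fun x _ ↦ rfl)
        (fun x _ ↦ rfl) hH0
    · simp only [Din, sIn, hj, if_false]
      rw [coordH_eq_flatField hF, coordK_eq_zeroField hF]
      exact hHj j hj
  obtain ⟨G, hGvac, hGB, hGsock⟩ := exists_sitesSurgery hmot B Din c s sIn sOut hs hsep hBvac hDinvac hHj'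
  -- `G = B` beyond `ρ₃/256`
  have hGB' : ∀ y : E3, ρ₃ / 256 ≤ ‖y‖ → G.SameAt B y := fun y hy ↦ hGB y fun j ↦ by
    have h1 := hcs j
    have h2 : ‖y‖ ≤ ‖y - c j‖ + ‖c j‖ := by
      calc ‖y‖ = ‖(y - c j) + c j‖ := by rw [sub_add_cancel]
        _ ≤ ‖y - c j‖ + ‖c j‖ := norm_add_le _ _
    linarith [hs j]
  -- §3 the end
  obtain ⟨P, hPvac, hPext, hPG⟩ :=
    exists_capEnd hη hmot hρ₃ (hcap M ρ₃ X₃ hM hρ₃ hX₃ hX₃ρ₃) hSe hGvac hGB' hHend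
  -- §4 bookkeeping
  have hs0 := hs 0
  have hc64 : 64 * s 0 < ρ₃ / 256 := by
    have := hcs 0
    rw [hc0, norm_zero, zero_add] at this
    exact this
  refine ⟨m / 64, ρ₃, s 0, P, by positivity, ?_, hρ₃, hρ₃M, hs0, by linarith,
    isVacuumConstraintSolution_of_vacAt hPvac, fun y hy ↦ hPext y (by linarith), fun y hy1 hy2 ↦ ?_⟩
  · have : m ≤ μ₀ := hmle.trans (min_le_left _ _)
    linarith
  · -- the socket annulus `{s 0 < |y| < 2 s 0}` reads `Gr₀` at scale `s 0`
    obtain ⟨hh, hk⟩ := hPG y (by linarith)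
    have hyc : ‖y - c 0‖ < 2 * s 0 := by rwa [hc0, sub_zero]
    have hyn : 0 < ‖y‖ := by linarith
    have hy' : 1 / 2 < ‖(s 0)⁻¹ • (y - c 0)‖ := by
      rw [hc0, sub_zero, norm_smul, Real.norm_eq_abs, abs_of_pos (inv_pos.2 hs0), lt_inv_mul_iff₀ hs0]
      linarith
    obtain ⟨hGrH, hGrK⟩ := hGr₀f _ hy'
    have hs2 : (s 0) ^ 2 ≠ 0 := pow_ne_zero 2 hs0.ne'
    refine ⟨fun v w ↦ ?_, ?_⟩
    · obtain ⟨e1, -⟩ := hGsock 0 y v w hyc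
      rw [hDin0] at e1
      have e2 : Gr₀.h.inner ((s 0)⁻¹ • (y - c 0)) v w = schwField (m / 64) ((s 0)⁻¹ • (y - c 0)) v w := by
        rw [← coordH_apply, hGrH]
      rw [show P.h.inner y v w = G.h.inner y v w by rw [hh], ← inv_mul_cancel_left₀ hs2 (G.h.inner y v w), e1, e2,
        schwField_apply, hc0, sub_zero, norm_smul, Real.norm_eq_abs, abs_of_pos (inv_pos.2 hs0)]
      rw [show m / 64 / (2 * ((s 0)⁻¹ * ‖y‖)) = s 0 * (m / 64) / (2 * ‖y‖) by field_simp]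
      ring
    · ext v w
      obtain ⟨-, e1⟩ := hGsock 0 y v w hyc
      rw [hDin0] at e1
      have e2 : Gr₀.k ((s 0)⁻¹ • (y - c 0)) v w = 0 := by
        rw [← coordK_apply, hGrK]
        rfl
      have h0 : G.k y v w = 0 := (mul_eq_zero.1 (e1.trans e2)).resolve_left hs2
      rw [show P.k y v w = G.k y v w by rw [hk], h0]
      rfl

end Summit.FinalStateConjecture.FinalStateConjecture.Theorems.SwallowTheDatum.UniversalWitnessFamily

end
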